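import Mathlib.Algebra.BigOperators.Intervals
import Mathlib.Algebra.BigOperators.Ring.Finset
import Mathlib.Algebra.Order.BigOperators.Group.LocallyFinite
import Mathlib.Tactic.Ring
import Mathlib.Tactic.LinearCombination
import Mathlib.Tactic.NormNum
import HarnessLib

/-!
# Volkov ZhETF 149 (2016) Appendix C eq. (50) (= JETP 122 (2016) eq. (C.7)) «represent (44) in the following form», PROVED as an identity for every chain length n and every index H; and PRD 109, 036012 (2024) §III item 3 «If 𝔴 = 3 and U₃ = L, we rewrite the expression differently for a given index H of the inverse transition»: its four-line display EQUALS the 𝔴 = 3 expression PLUS an explicit group of L_{G_H}-terms (PROVED for every n, H) — ONE PRINT-CHECK DATUM — and the 2016 form with its (1 − ·) multipliers kept, U ↦ L, IS the identity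

independent recomputation; certified where stated, statistical where stated; no new-physics claim.

CITATION HEADER (venture `QEDPrecision`, cell `pub-qed`, track TROPICAL seat V3b = `pub-qed-trop-v3-lit-2` gen 37; VALUE-FREE: polynomial
identities between PRINTED OPERATOR EXPRESSIONS of the nested-chain forest formula, read as commuting symbols — no amplitude, no integral, no
graph of the cell, nothing per word, nothing of X352). Companion of `Volkov2024PRD109.ForestFormulaCases` (the printed operator CASE TABLES and
worked examples as signed symbol lists, `decide`), `Volkov2024PRD109.OnShellEquivalenceWardCancellation` (§IV B / §IV C step 7) and
`Volkov2024PRD109.InPlaceOnShellRenormalization` (§IV A and [69]'s 2-loop table): this file types the ONE display of §III («Divergence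
elimination») that carries an algebraic claim — item 3 of the list «The difference with the investigation in [69] is the following» — together
with the 2016 display (C.7) it modifies. Serves HOME `tropical/view/V3-VOLKOV-DEGREES.md` §B B.4 («§III states the mechanism at the physical
level of rigour») and HOME `tropical/lit/SOURCES.md` (errata column).

Sources, VERBATIM.
* [Volkov2016] S. A. Volkov, ZhETF 149 (6), 1164–1191 (2016) (Russian original, held by the cell: HOME
  `data/lit/sources/.cache/journal-pdf-pages/ZhETF149-1164-Volkov2016/` p0025–p0027 = journal pp. 1188–1190; `lit read paper:url-4c31fc50978c`)
  = J. Exp. Theor. Phys. 122 (6), 1008–1031 (2016) (English translation; its Appendix C equations (C.1)–(C.8) = the original's (44)–(51); the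
  English pages are cite-only for the cell, acq-09812). Appendix C treats the graph of its Fig. 8: a vertexlike graph G whose UV-divergent
  subgraphs are a nested chain G₁ ⊂ G₂ ⊂ … ⊂ G_n ⊂ G_{n+1} = G of elements of 𝕴[G]. p.1188, eq. (44): «Вклад графа G в a_{e,1} равен» ⟦the
  contribution of the graph G to a_{e,1} equals⟧
    (44)  A_G(1−U_{G_n})…(1−U_{G_1})f_G − (L_G − U_G)A_{G_n}(1−U_{G_{n−1}})…(1−U_{G_1})f_G
          − (L_G − U_G)(1−L_{G_n})A_{G_{n−1}}(1−U_{G_{n−2}})…(1−U_{G_1})f_G − … − (L_G − U_G)(1−L_{G_n})…(1−L_{G_2})A_{G_1}f_G.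
  p.1188: «Индекс j, 1 ≤ j ≤ n, будем называть индексом перехода для вектора расходимости [v;w], если v_j > v_{j−1}. Соответственно, индекс j,
  1 ≤ j ≤ n, называется индексом обратного перехода, если v_j < v_{j−1}.» ⟦j is a transition index of the divergence vector [v;w] if v_j >
  v_{j−1}, an inverse transition index if v_j < v_{j−1}⟧. p.1189, eq. (50): «Для того чтобы показать отсутствие расходимости типа [v;w] в (44),
  положим H равным некоторому индексу обратного перехода в [v;w], представим (44) в следующем виде:» ⟦To show the absence of a divergence of
  type [v;w] in (44), set H equal to some inverse transition index of [v;w] and REPRESENT (44) IN THE FOLLOWING FORM:⟧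
    (50)  − Σ_{1≤l<H} ( (L_G − U_G)(1−L_{G_n})…(1−L_{G_{l+1}}) A_{G_l} (1−U_{G_{l−1}})…(1−U_{G_1}) f_G )
          + Σ_{H<l≤n} ( (L_G − U_G)(1−L_{G_n})…(1−L_{G_{l+1}}) [L_{G_l}A_{G_H} − A_{G_l}(1−U_{G_{l−1}})…(1−U_{G_H})] (1−U_{G_{H−1}})…(1−U_{G_1}) f_G )
          + [A_G(1−U_{G_n})…(1−U_{G_H}) − (L_G − U_G)A_{G_H}] (1−U_{G_{H−1}})…(1−U_{G_1}) f_G.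
  p.1189 (after (51)): «слагаемые, содержащие хотя бы один из операторов U_{G_H}, U_{G_{H+1}}, …, свободны от расходимости [v;w] в связи с
  равенством (49)» ⟦the terms containing at least one of the operators U_{G_H}, U_{G_{H+1}}, … are free of the divergence [v;w] owing to (49)⟧.
* [Volkov2024PRD109] S. Volkov, Phys. Rev. D 109, 036012 (2024) = arXiv:2308.11560v4 (the held e-print `method_details_2023.tex`; arXiv PDF
  p.10 L22–L80 as materialised by `lit read arxiv:2308.11560`; tex l.439–463; the journal page is not held by the cell). §III: «We will refer
  to the index j, 1 ≤ j ≤ n as a transition index for the divergence vector [v,w] if v_j > v_{j−1}. Correspondingly, the index j is called an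
  inverse transition index if v_j < v_{j−1}. The difference with the investigation in [69] is the following: 1. An index j is called separating
  in a term of the expression if there is an operator A_{G_j}, L_{G_j} or (U₃)_{G_j} (U₃ = L) in this term. The difference with [69] is the
  possibility to take U₃ (if it is equal to L). 2. If 𝔴 = 3, then no consideration of the case v₀ > w₀ is necessary; this case cannot produce
  divergence in a term, because G₁ has its external photon on a lepton loop. 3. If 𝔴 = 3 and U₃ = L, we rewrite the expression differently
  for a given index H of the inverse transition in [v,w]:
    − Σ_{1≤l<H} ( (L_G − (U₁)_G)(1−L_{G_n})…(1−L_{G_{l+1}}) A_{G_l} (1−L_{G_{l−1}})…(1−L_{G_1}) )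
    + Σ_{H<l≤n} ( (L_G − (U₁)_G)(1−L_{G_n})…(1−L_{G_{l+1}}) [L_{G_l}A_{G_H} − A_{G_l}] (1−L_{G_{H−1}})…(1−L_{G_1}) )
    + [A_G − (L_G − (U₁)_G)A_{G_H}] (1−L_{G_{H−1}})…(1−L_{G_1})
    + Σ_{H<l≤n} [ ( A_G(1−L_{G_n})…(1−L_{G_{l+1}}) − (L_G − (U₁)_G) Σ_{l<k≤n} ( A_{G_k} ∏_{l<r≤n, r≠k} (1−L_{G_r}) ) )
                  × [L_{G_l}L_{G_H} − L_{G_l}] (1−L_{G_{H−1}})…(1−L_{G_1}) ].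
  The last term was added to (C.7) in [69], inappropriate (1 − U) multipliers were removed. The factor L_{G_l}L_{G_H} − L_{G_l} cancels the
  divergence in this term, analogous to the other terms. This argument shows how it works, but a full rigorous examination seems difficult and
  cumbersome; we rely on a numerical check (see Section V).» The «expression» is §II's forest formula Σ_{F∈𝔉[G], G′∈𝔍[G]∩F} (−1)^{n−1}
  S^{G′}_{G₁}…S^{G′}_{G_n} (typed as the case table `ForestFormulaCases.S23`): for the chain G₁ ⊂ … ⊂ G_n ⊂ G of 𝔍-members with 𝔴 = 3 it gives
  S_{G′} = A, S_G = L_G − (U₁)_G (G ≠ G′), S_{G_k} = L_{G_k} for G′ ⊂ G_k ⊂ G and S_{G_k} = (U_𝔴)_{G_k} = (U₃)_{G_k} for G_k ⊂ G′; with U₃ = L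
  this is (44) with U_{G_k} ↦ L_{G_k} and (L_G − U_G) ↦ (L_G − (U₁)_G) (`expr23`; its n = 1 instance is the first bracket of §III's own Fig. 4
  example «[A_G − A_G (U₃)_{bcdfghi} − (L−U₁)_G A_{bcdfghi}]», cf. `ForestFormulaCases.sec3_2023_U3_eq_forest`).

MODEL (the reading, stated once). As in `ForestFormulaCases` — where a forest-formula term IS a sign times the list of (subgraph, operator symbol)
pairs — the operator symbols A_G, (L_G − U_G) resp. (L_G − (U₁)_G), A_{G_k}, L_{G_k}, U_{G_k} (1 ≤ k ≤ n) of DISTINCT subgraphs are read as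
commuting indeterminates: `aG`, `yG`, `A k`, `L k`, `U k`, arbitrary elements of an arbitrary commutative ring R (the common right factor f_G of
the 2016 displays is dropped). «Expand the parentheses», «represent (44) in the form (50)», «rewrite the expression» are then polynomial
identities in these symbols, and an identity proved for every commutative ring and all values of the symbols is an identity of the free
commutative ring on them, i.e. of the printed operator expressions term by term (every monomial of every display below carries each subgraph
at most once, so a monomial determines an operator term uniquely; the application order is fixed by inclusion, §II). Products of multipliers
over a range of chain indices are `omProd X i j` = ∏_{i ≤ k < j} (1 − X_k); the printed ranges «1 ≤ l < H», «H < l ≤ n», «l < k ≤ n» are the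
intervals `Finset.Ico 1 H`, `Finset.Ico (H+1) (n+1)`, `Finset.Ico (l+1) (n+1)`.

WHAT IS PROVED (namespace `…Volkov2024PRD109.InverseTransitionRegrouping`; 0 named facts, 0 sorry):
* `expr44` = (44); `eq50` = (50); **`eq50_eq_expr44`** — (50) = (44) for every n ≥ 1 and every 1 ≤ H ≤ n (the 2016 display IS a
  representation of (44), for any index H whatsoever — the hypothesis «H an inverse transition index» is not needed for the algebra); the proof is
  the telescoping identity `sum_mul_omProd` (Σ_{i≤l<j} X_l ∏_{l<k<j}(1−X_k) = 1 − ∏_{i≤k<j}(1−X_k)) applied to the bracket [L_{G_l}A_{G_H} − …].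
* `expr23` = the 𝔴 = 3, U₃ = L expression (= `expr44` with U ↦ L); `display23` = the printed four-line display; `quot n l` = its fourth line's
  first factor Φ_l = A_G(1−L_{G_n})…(1−L_{G_{l+1}}) − (L_G − (U₁)_G)Σ_{l<k≤n} A_{G_k}∏_{l<r≤n, r≠k}(1−L_{G_r}) (`quot_zero`: Φ₀ = the expression
  itself); `resid23 n H` = R_H := L_{G_H}(1−L_{G_{H−1}})…(1−L_{G_1})·[A_G − (L_G − (U₁)_G) Σ_{H<m≤n} (1−L_{G_n})…(1−L_{G_{m+1}}) A_{G_m}].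
  **`display23_eq`** — display = expression + R_H, for every n ≥ 1 and 1 ≤ H ≤ n (telescoping twice and one exchange of a triangular double
  sum, `sum_L_mul_quot`); `resid23_eq_quot_form` — R_H = L_{G_H}(1−L_{G_{H−1}})…(1−L_{G_1})·[Φ_H + Σ_{H<l≤n} L_{G_l}Φ_l]; `display23_eq_expr23_of`
  — setting the symbol L_{G_H} to 0 makes display = expression: every monomial of R_H contains L_{G_H}, and its A-symbol is A_G or A_{G_m} with
  m > H, so in the operator reading what the display leaves out is a group of terms with L applied to G_H INSIDE G′ (G_H ⊂ G′) and no
  multiplier (1 − L_{G_H}).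
* **`eq50L_eq_expr23`** — the 2016 form (50) with U_{G_k} ↦ L_{G_k}, i.e. WITH the multipliers (1−L_{G_{l−1}})…(1−L_{G_H}) in line 2 and
  (1−L_{G_n})…(1−L_{G_H}) in line 3 kept, equals the 2023 expression (three lines, no fourth line needed); **`display23Corrected_eq_expr23`** —
  keeping the printed lines 1–3 of 2023, the identity holds iff the fourth line is − Σ_{H≤l≤n} Φ_l · L_{G_l} · (1−L_{G_{H−1}})…(1−L_{G_1})
  (sum from l = H, bracket −L_{G_l} in place of L_{G_l}L_{G_H} − L_{G_l}): `display23Corrected`, and `display23Corrected_sub_display23` = −R_H.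
* Small cases by `simp` for the reader: `expr44_one/_two`, `eq50_two_one`, `expr23_one/_two`, `display23_one`, `display23_two_one/_two_two`
  (n = 1: expression A_G(1−L_{G_1}) − (L_G − (U₁)_G)A_{G_1}, display A_G − (L_G − (U₁)_G)A_{G_1}: the term −A_G L_{G_1} = −A_G(U₃)_{G_1} is the
  residual).
PRINT-CHECK DATUM (arXiv v4 = the held e-print): **`display23_ne_expr23`** / **`display23_not_an_identity`** — for EVERY n ≥ 1 and EVERY
1 ≤ H ≤ n the printed four-line display is NOT equal to the expression as a polynomial in the operator symbols: in ℤ, at A_G = 1, L_G − (U₁)_G =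
0, A_{G_k} = 0, L_{G_k} = [k = H], display − expression = R_H = 1 (`resid23_witness`). Reading, labelled: the sentence «we rewrite the expression»
holds for the 2016 form transported to U₃ = L (`eq50L_eq_expr23`) and for the corrected fourth line (`display23Corrected_eq_expr23`); as printed,
removing the «(1 − U) multipliers» from lines 2–3 and adding the printed fourth line leaves out exactly the group R_H of terms with an inner
L_{G_H} and no factor (1 − L_{G_H}). Whether those terms are separately free of the divergence [v;w] is NOT printed in PRD 109 (ZhETF p.1189
prints the corresponding sentence for the 2016 operators U_{G_H}, U_{G_{H+1}}, …, by its (49), an identity for U, not for L) — NOT CLAIMED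
either way here. §III is expressly heuristic («a full rigorous examination seems difficult and cumbersome; we rely on a numerical check»); no
printed number and no computation of [Volkov2024PRD109] uses this display.
NOT CLAIMED (print / physics, not typed): divergence vectors, which terms diverge, (48)–(49)/(51), items 1–2, the case 𝔴 = 1, anything about
amplitudes, integrals or values; that the operators commute as maps (only the symbol bookkeeping of the printed displays is typed).
-/

open Finset

namespace Literature.MathematicalPhysics.QuantumFieldTheory.Volkov2024PRD109

namespace InverseTransitionRegrouping

variable {R : Type*} [CommRing R]

/-! ## §1 Range products of the printed multipliers and the telescoping identity -/

/-- `omProd X i j` = ∏_{i ≤ k < j} (1 − X k): a printed string of multipliers «(1 − L_{G_{j−1}}) … (1 − L_{G_i})» (or with U) over a range of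
chain indices, as ONE commuting factor (empty range = 1). [cite: Volkov2016, App. C eq. (44) (ZhETF 149 p.1188)] -/
def omProd (X : ℕ → R) (i j : ℕ) : R := ∏ k ∈ Ico i j, (1 - X k)

/-- Empty range. [folklore] -/
private theorem omProd_self (X : ℕ → R) (i : ℕ) : omProd X i i = 1 := by simp [omProd]

/-- Peel the top multiplier. [folklore] -/
private theorem omProd_succ_top (X : ℕ → R) {i j : ℕ} (h : i ≤ j) :
    omProd X i (j + 1) = omProd X i j * (1 - X j) := by
  unfold omProd; rw [prod_Ico_succ_top h]

/-- Peel the bottom multiplier. [folklore] -/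
private theorem omProd_succ_bot (X : ℕ → R) {i j : ℕ} (h : i < j) :
    omProd X i j = (1 - X i) * omProd X (i + 1) j := by
  unfold omProd; rw [prod_eq_prod_Ico_succ_bot h]

/-- Consecutive ranges multiply. [folklore] -/
private theorem omProd_mul_omProd (X : ℕ → R) {i j k : ℕ} (hij : i ≤ j) (hjk : j ≤ k) :
    omProd X i j * omProd X j k = omProd X i k :=
  prod_Ico_consecutive _ hij hjk

/-- TELESCOPING: Σ_{i ≤ l < j} X_l · ∏_{l < k < j}(1 − X_k) = 1 − ∏_{i ≤ k < j}(1 − X_k) — the one identity behind «expand the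
parentheses» in both displays. [folklore] -/
private theorem sum_mul_omProd (X : ℕ → R) {i j : ℕ} (h : i ≤ j) :
    ∑ l ∈ Ico i j, X l * omProd X (l + 1) j = 1 - omProd X i j := by
  induction j, h using Nat.le_induction with
  | base => simp [omProd]
  | succ j hij ih =>
      rw [sum_Ico_succ_top hij, omProd_self, mul_one, omProd_succ_top X hij]
      have : ∑ l ∈ Ico i j, X l * omProd X (l + 1) (j + 1)
          = (∑ l ∈ Ico i j, X l * omProd X (l + 1) j) * (1 - X j) := by
        rw [sum_mul]
        refine sum_congr rfl fun l hl => ?_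
        rw [omProd_succ_top X (by simp only [mem_Ico] at hl; omega)]
        ring
      rw [this, ih]
      ring

/-! ## §2 ZhETF (44) and (50) = JETP (C.1)-shape and (C.7): the 2016 representation IS an identity

Symbols: `aG` = A_G, `yG` = (L_G − U_G), `A k` = A_{G_k}, `L k` = L_{G_k}, `U k` = U_{G_k}; f_G dropped. -/

variable (aG yG : R) (A L U : ℕ → R)

/-- (44) AS PRINTED: A_G(1−U_{G_n})…(1−U_{G_1}) − Σ_{l=1}^{n} (L_G − U_G)(1−L_{G_n})…(1−L_{G_{l+1}}) A_{G_l} (1−U_{G_{l−1}})…(1−U_{G_1})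
(the printed sum runs l = n, n−1, …, 1). [cite: Volkov2016, App. C eq. (44) (ZhETF 149 p.1188; JETP 122 (C.1))] -/
def expr44 (n : ℕ) : R :=
  aG * omProd U 1 (n + 1) - yG * ∑ l ∈ Ico 1 (n + 1), omProd L (l + 1) (n + 1) * A l * omProd U 1 l

/-- (50) = (C.7) AS PRINTED, for the index H: line 1 (1 ≤ l < H), line 2 (H < l ≤ n) with the bracket
[L_{G_l}A_{G_H} − A_{G_l}(1−U_{G_{l−1}})…(1−U_{G_H})], line 3 [A_G(1−U_{G_n})…(1−U_{G_H}) − (L_G − U_G)A_{G_H}](1−U_{G_{H−1}})…(1−U_{G_1}).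
[cite: Volkov2016, App. C eq. (50) (ZhETF 149 p.1189; JETP 122 (C.7))] -/
def eq50 (n H : ℕ) : R :=
  -(∑ l ∈ Ico 1 H, yG * omProd L (l + 1) (n + 1) * A l * omProd U 1 l)
  + (∑ l ∈ Ico (H + 1) (n + 1),
      yG * omProd L (l + 1) (n + 1) * (L l * A H - A l * omProd U H l) * omProd U 1 H)
  + (aG * omProd U H (n + 1) - yG * A H) * omProd U 1 H

/-- n = 1: (44) reads A_G(1−U_{G_1}) − (L_G − U_G)A_{G_1}. [cite: Volkov2016, App. C eq. (44) (ZhETF 149 p.1188)] -/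
theorem expr44_one : expr44 aG yG A L U 1 = aG * (1 - U 1) - yG * A 1 := by
  simp [expr44, omProd]

/-- Ico 1 3 = {1, 2}. [folklore] -/
private theorem Ico_one_three : Finset.Ico 1 3 = {1, 2} := by decide

/-- n = 2: (44) reads A_G(1−U_{G_2})(1−U_{G_1}) − (L_G − U_G)A_{G_2}(1−U_{G_1}) − (L_G − U_G)(1−L_{G_2})A_{G_1}.
[cite: Volkov2016, App. C eq. (44) (ZhETF 149 p.1188)] -/
theorem expr44_two :
    expr44 aG yG A L U 2 = aG * ((1 - U 1) * (1 - U 2)) - yG * ((1 - L 2) * A 1 + A 2 * (1 - U 1)) := by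
  simp [expr44, omProd, Ico_one_three]

/-- n = 2, H = 1: (50) reads (L_G − U_G)[L_{G_2}A_{G_1} − A_{G_2}(1−U_{G_1})] + [A_G(1−U_{G_2})(1−U_{G_1}) − (L_G − U_G)A_{G_1}].
[cite: Volkov2016, App. C eq. (50) (ZhETF 149 p.1189)] -/
theorem eq50_two_one :
    eq50 aG yG A L U 2 1
      = yG * (L 2 * A 1 - A 2 * (1 - U 1)) + (aG * ((1 - U 1) * (1 - U 2)) - yG * A 1) := by
  simp [eq50, omProd, Ico_one_three]

/-- **(50) = (44)** «представим (44) в следующем виде» — for EVERY chain length n ≥ 1 and EVERY index 1 ≤ H ≤ n (no hypothesis on the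
divergence vector is needed for the algebra). [cite: Volkov2016, App. C eqs. (44), (50) (ZhETF 149 pp. 1188–1189; JETP 122 (C.1), (C.7))] -/
theorem eq50_eq_expr44 {n H : ℕ} (hH : 1 ≤ H) (hHn : H ≤ n) :
    eq50 aG yG A L U n H = expr44 aG yG A L U n := by
  unfold eq50 expr44
  have hsplit : ∑ l ∈ Ico 1 (n + 1), omProd L (l + 1) (n + 1) * A l * omProd U 1 l
      = (∑ l ∈ Ico 1 H, omProd L (l + 1) (n + 1) * A l * omProd U 1 l)
        + omProd L (H + 1) (n + 1) * A H * omProd U 1 H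
        + ∑ l ∈ Ico (H + 1) (n + 1), omProd L (l + 1) (n + 1) * A l * omProd U 1 l := by
    rw [← sum_Ico_consecutive _ hH (by omega : H ≤ n + 1),
      sum_eq_sum_Ico_succ_bot (by omega : H < n + 1)]
    ring
  have hline1 : ∑ l ∈ Ico 1 H, yG * omProd L (l + 1) (n + 1) * A l * omProd U 1 l
      = yG * ∑ l ∈ Ico 1 H, omProd L (l + 1) (n + 1) * A l * omProd U 1 l := by
    rw [mul_sum]
    exact sum_congr rfl fun l _ => by ring
  have hline2 : ∑ l ∈ Ico (H + 1) (n + 1),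
        yG * omProd L (l + 1) (n + 1) * (L l * A H - A l * omProd U H l) * omProd U 1 H
      = yG * A H * omProd U 1 H * (∑ l ∈ Ico (H + 1) (n + 1), L l * omProd L (l + 1) (n + 1))
        - yG * ∑ l ∈ Ico (H + 1) (n + 1), omProd L (l + 1) (n + 1) * A l * omProd U 1 l := by
    rw [mul_sum, mul_sum, ← sum_sub_distrib]
    refine sum_congr rfl fun l hl => ?_
    have hl' : H ≤ l := by simp only [mem_Ico] at hl; omega
    rw [← omProd_mul_omProd U hH hl']
    ring
  have htel := sum_mul_omProd L (show H + 1 ≤ n + 1 by omega)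
  have hU : omProd U 1 H * omProd U H (n + 1) = omProd U 1 (n + 1) :=
    omProd_mul_omProd U hH (by omega)
  rw [hsplit, hline1, hline2, htel]
  linear_combination aG * hU

/-! ## §3 PRD 109 §III item 3 (𝔴 = 3, U₃ = L): the expression, the printed display, and what the display leaves out

Symbols: `aG` = A_G, `yG` = (L_G − (U₁)_G), `A k` = A_{G_k}, `L k` = L_{G_k}; the inner operators (U_𝔴)_{G_k} = (U₃)_{G_k} = L_{G_k}. -/

/-- Φ_l — the first factor of the printed fourth line: A_G(1−L_{G_n})…(1−L_{G_{l+1}}) − (L_G − (U₁)_G) Σ_{l<k≤n} A_{G_k} ∏_{l<r≤n, r≠k}(1−L_{G_r})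
(= the (44)-shaped expression of the sub-chain G_{l+1} ⊂ … ⊂ G_n ⊂ G with U₃ = L inside; Φ₀ is the whole expression, `quot_zero`).
[cite: Volkov2024PRD109, §III item 3, fourth line of the display (arXiv v4 p.10; tex l.454)] -/
def quot (n l : ℕ) : R :=
  aG * omProd L (l + 1) (n + 1)
    - yG * ∑ k ∈ Ico (l + 1) (n + 1), A k * (omProd L (l + 1) k * omProd L (k + 1) (n + 1))

/-- «the expression» for 𝔴 = 3, U₃ = L on the chain G₁ ⊂ … ⊂ G_n ⊂ G of 𝔍-members: §II's forest formula gives S_{G′} = A, S_G = L_G − (U₁)_G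
(G ≠ G′), S_{G_k} = L_{G_k} (G′ ⊂ G_k ⊂ G), S_{G_k} = (U₃)_{G_k} = L_{G_k} (G_k ⊂ G′) — i.e. (44) with U ↦ L and (L_G − U_G) ↦ (L_G − (U₁)_G).
[cite: Volkov2024PRD109, §II (forest formula, the cases S^{G′}_{G″}; arXiv v4 p.7) and §III item 3 (p.10 L29)] [cite: Volkov2016, App. C eq. (44)] -/
def expr23 (n : ℕ) : R := expr44 aG yG A L L n

/-- The printed four-line display of §III item 3, AS PRINTED (line 2 bracket [L_{G_l}A_{G_H} − A_{G_l}], line 3 [A_G − (L_G − (U₁)_G)A_{G_H}],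
line 4 with the bracket [L_{G_l}L_{G_H} − L_{G_l}], all sums «H < l ≤ n»). [cite: Volkov2024PRD109, §III item 3 (arXiv v4 p.10 L29–L76; tex l.443–459)] -/
def display23 (n H : ℕ) : R :=
  -(∑ l ∈ Ico 1 H, yG * omProd L (l + 1) (n + 1) * A l * omProd L 1 l)
  + (∑ l ∈ Ico (H + 1) (n + 1), yG * omProd L (l + 1) (n + 1) * (L l * A H - A l) * omProd L 1 H)
  + (aG - yG * A H) * omProd L 1 H
  + ∑ l ∈ Ico (H + 1) (n + 1), quot aG yG A L n l * (L l * L H - L l) * omProd L 1 H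

/-- R_H — the group the printed display leaves out: L_{G_H}(1−L_{G_{H−1}})…(1−L_{G_1})·[A_G − (L_G − (U₁)_G) Σ_{H<m≤n} (1−L_{G_n})…(1−L_{G_{m+1}}) A_{G_m}]
(this seat's closed form; every monomial carries L_{G_H} and no multiplier (1 − L_{G_H})). [cite: Volkov2024PRD109, §III item 3 (arXiv v4 p.10)] -/
def resid23 (n H : ℕ) : R :=
  L H * omProd L 1 H * (aG - yG * ∑ m ∈ Ico (H + 1) (n + 1), omProd L (m + 1) (n + 1) * A m)

/-- Φ₀ = the expression. [cite: Volkov2024PRD109, §III item 3 (arXiv v4 p.10)] -/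
theorem quot_zero (n : ℕ) : quot aG yG A L n 0 = expr23 aG yG A L n := by
  unfold quot expr23 expr44
  congr 1
  congr 1
  exact sum_congr rfl fun k _ => by ring

/-- n = 1 (𝔍[G] = {G₁, G}, the shape of §III's Fig. 4 example with U₃ = L): the expression is A_G(1−L_{G_1}) − (L_G − (U₁)_G)A_{G_1}.
[cite: Volkov2024PRD109, §III (Fig. 4 example «[A_G − A_G (U₃)_{bcdfghi} − (L−U₁)_G A_{bcdfghi}]», arXiv v4 p.9) and item 3] -/
theorem expr23_one : expr23 aG yG A L 1 = aG * (1 - L 1) - yG * A 1 := by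
  simp [expr23, expr44, omProd]

/-- n = 1, H = 1: the printed display is A_G − (L_G − (U₁)_G)A_{G_1} (lines 1, 2, 4 are empty sums) — the term −A_G L_{G_1} of the expression is
absent. [cite: Volkov2024PRD109, §III item 3 (arXiv v4 p.10)] -/
theorem display23_one : display23 aG yG A L 1 1 = aG - yG * A 1 := by
  simp [display23, omProd]

/-- n = 2: the expression is A_G(1−L_{G_1})(1−L_{G_2}) − (L_G − (U₁)_G)[(1−L_{G_2})A_{G_1} + A_{G_2}(1−L_{G_1})].
[cite: Volkov2024PRD109, §III item 3 (arXiv v4 p.10)] -/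
theorem expr23_two :
    expr23 aG yG A L 2 = aG * ((1 - L 1) * (1 - L 2)) - yG * ((1 - L 2) * A 1 + A 2 * (1 - L 1)) := by
  simp [expr23, expr44, omProd, Ico_one_three]

/-- n = 2, H = 1: the printed display is (L_G − (U₁)_G)[L_{G_2}A_{G_1} − A_{G_2}] + [A_G − (L_G − (U₁)_G)A_{G_1}] + A_G[L_{G_2}L_{G_1} − L_{G_2}]
(minus the expression: A_G L_{G_1} − (L_G − (U₁)_G)A_{G_2}L_{G_1} = R₁). [cite: Volkov2024PRD109, §III item 3 (arXiv v4 p.10)] -/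
theorem display23_two_one :
    display23 aG yG A L 2 1
      = yG * (L 2 * A 1 - A 2) + (aG - yG * A 1) + aG * (L 2 * L 1 - L 2) := by
  simp [display23, quot, omProd]

/-- n = 2, H = 2: the printed display is −(L_G − (U₁)_G)(1−L_{G_2})A_{G_1} + [A_G − (L_G − (U₁)_G)A_{G_2}](1−L_{G_1}) (lines 2 and 4 empty; minus the
expression: A_G L_{G_2}(1−L_{G_1}) = R₂). [cite: Volkov2024PRD109, §III item 3 (arXiv v4 p.10)] -/
theorem display23_two_two :
    display23 aG yG A L 2 2 = -(yG * (1 - L 2) * A 1) + (aG - yG * A 2) * (1 - L 1) := by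
  simp [display23, quot, omProd]

/-- Σ_{H<l≤n} L_{G_l}·Φ_l in closed form: A_G[1 − (1−L_{G_n})…(1−L_{G_{H+1}})] − (L_G − (U₁)_G) Σ_{H<k≤n} (1−L_{G_n})…(1−L_{G_{k+1}}) A_{G_k}
[1 − (1−L_{G_{k−1}})…(1−L_{G_{H+1}})] — telescoping once in the A_G part and, after exchanging the triangular double sum, once more inside.
[cite: Volkov2024PRD109, §III item 3 (arXiv v4 p.10)] -/
theorem sum_L_mul_quot {n H : ℕ} (hHn : H ≤ n) :
    ∑ l ∈ Ico (H + 1) (n + 1), L l * quot aG yG A L n l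
      = aG * (1 - omProd L (H + 1) (n + 1))
        - yG * ∑ k ∈ Ico (H + 1) (n + 1),
            omProd L (k + 1) (n + 1) * A k * (1 - omProd L (H + 1) k) := by
  have h1 : ∑ l ∈ Ico (H + 1) (n + 1), L l * quot aG yG A L n l
      = aG * (∑ l ∈ Ico (H + 1) (n + 1), L l * omProd L (l + 1) (n + 1))
        - yG * ∑ l ∈ Ico (H + 1) (n + 1), ∑ k ∈ Ico (l + 1) (n + 1),
            L l * (A k * (omProd L (l + 1) k * omProd L (k + 1) (n + 1))) := by
    rw [mul_sum, mul_sum, ← sum_sub_distrib]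
    refine sum_congr rfl fun l _ => ?_
    have : L l * quot aG yG A L n l
        = L l * (aG * omProd L (l + 1) (n + 1))
          - L l * (yG * ∑ k ∈ Ico (l + 1) (n + 1), A k * (omProd L (l + 1) k * omProd L (k + 1) (n + 1))) := by
      rw [quot, mul_sub]
    rw [this]
    simp only [mul_sum]
    congr 1
    · ring
    · exact sum_congr rfl fun k _ => by ring
  rw [h1, sum_mul_omProd L (show H + 1 ≤ n + 1 by omega), sum_Ico_Ico_comm']
  congr 1
  congr 1
  refine sum_congr rfl fun k hk => ?_
  have hk' : H + 1 ≤ k := by simp only [mem_Ico] at hk; omega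
  have : ∑ l ∈ Ico (H + 1) k, L l * (A k * (omProd L (l + 1) k * omProd L (k + 1) (n + 1)))
      = A k * omProd L (k + 1) (n + 1) * ∑ l ∈ Ico (H + 1) k, L l * omProd L (l + 1) k := by
    rw [mul_sum]
    exact sum_congr rfl fun l _ => by ring
  rw [this, sum_mul_omProd L hk']
  ring

/-- **THE PRINTED DISPLAY = THE EXPRESSION + R_H**, for every n ≥ 1 and every 1 ≤ H ≤ n.
[cite: Volkov2024PRD109, §III item 3 (arXiv v4 p.10 L29–L78; tex l.443–461)] -/
theorem display23_eq {n H : ℕ} (hH : 1 ≤ H) (hHn : H ≤ n) :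
    display23 aG yG A L n H = expr23 aG yG A L n + resid23 aG yG A L n H := by
  unfold display23 expr23 expr44 resid23
  have hsplit : ∑ l ∈ Ico 1 (n + 1), omProd L (l + 1) (n + 1) * A l * omProd L 1 l
      = (∑ l ∈ Ico 1 H, omProd L (l + 1) (n + 1) * A l * omProd L 1 l)
        + omProd L (H + 1) (n + 1) * A H * omProd L 1 H
        + ∑ l ∈ Ico (H + 1) (n + 1), omProd L (l + 1) (n + 1) * A l * omProd L 1 l := by
    rw [← sum_Ico_consecutive _ hH (by omega : H ≤ n + 1),
      sum_eq_sum_Ico_succ_bot (by omega : H < n + 1)]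
    ring
  have hline1 : ∑ l ∈ Ico 1 H, yG * omProd L (l + 1) (n + 1) * A l * omProd L 1 l
      = yG * ∑ l ∈ Ico 1 H, omProd L (l + 1) (n + 1) * A l * omProd L 1 l := by
    rw [mul_sum]
    exact sum_congr rfl fun l _ => by ring
  have hline2 : ∑ l ∈ Ico (H + 1) (n + 1),
        yG * omProd L (l + 1) (n + 1) * (L l * A H - A l) * omProd L 1 H
      = yG * A H * omProd L 1 H * (∑ l ∈ Ico (H + 1) (n + 1), L l * omProd L (l + 1) (n + 1))
        - yG * omProd L 1 H * ∑ l ∈ Ico (H + 1) (n + 1), omProd L (l + 1) (n + 1) * A l := by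
    rw [mul_sum, mul_sum, ← sum_sub_distrib]
    exact sum_congr rfl fun l _ => by ring
  have hline4 : ∑ l ∈ Ico (H + 1) (n + 1), quot aG yG A L n l * (L l * L H - L l) * omProd L 1 H
      = omProd L 1 H * (L H - 1) * ∑ l ∈ Ico (H + 1) (n + 1), L l * quot aG yG A L n l := by
    rw [mul_sum]
    exact sum_congr rfl fun l _ => by ring
  have hS3 : ∑ l ∈ Ico (H + 1) (n + 1), omProd L (l + 1) (n + 1) * A l * omProd L 1 l
      = omProd L 1 H * (1 - L H) *
          ∑ l ∈ Ico (H + 1) (n + 1), omProd L (l + 1) (n + 1) * A l * omProd L (H + 1) l := by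
    rw [mul_sum]
    refine sum_congr rfl fun l hl => ?_
    have hl' : H < l := by simp only [mem_Ico] at hl; omega
    rw [← omProd_mul_omProd L hH hl'.le, omProd_succ_bot L hl']
    ring
  have hsub : ∑ k ∈ Ico (H + 1) (n + 1), omProd L (k + 1) (n + 1) * A k * (1 - omProd L (H + 1) k)
      = (∑ k ∈ Ico (H + 1) (n + 1), omProd L (k + 1) (n + 1) * A k)
        - ∑ k ∈ Ico (H + 1) (n + 1), omProd L (k + 1) (n + 1) * A k * omProd L (H + 1) k := by
    rw [← sum_sub_distrib]
    exact sum_congr rfl fun k _ => by ring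
  have hP : omProd L 1 (n + 1) = omProd L 1 H * (1 - L H) * omProd L (H + 1) (n + 1) := by
    rw [← omProd_mul_omProd L hH (by omega : H ≤ n + 1), omProd_succ_bot L (by omega : H < n + 1)]
    ring
  have htel := sum_mul_omProd L (show H + 1 ≤ n + 1 by omega)
  rw [hsplit, hline1, hline2, hline4, sum_L_mul_quot aG yG A L hHn, hsub, htel, hS3, hP]
  ring

/-- Same statement as a difference: display − expression = R_H. [cite: Volkov2024PRD109, §III item 3 (arXiv v4 p.10)] -/
theorem display23_sub_expr23 {n H : ℕ} (hH : 1 ≤ H) (hHn : H ≤ n) :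
    display23 aG yG A L n H - expr23 aG yG A L n = resid23 aG yG A L n H := by
  rw [display23_eq aG yG A L hH hHn]; ring

/-- R_H in terms of the printed Φ's: R_H = L_{G_H}(1−L_{G_{H−1}})…(1−L_{G_1})·[Φ_H + Σ_{H<l≤n} L_{G_l}Φ_l].
[cite: Volkov2024PRD109, §III item 3 (arXiv v4 p.10)] -/
theorem resid23_eq_quot_form {n H : ℕ} (hHn : H ≤ n) :
    resid23 aG yG A L n H
      = L H * omProd L 1 H * (quot aG yG A L n H + ∑ l ∈ Ico (H + 1) (n + 1), L l * quot aG yG A L n l) := by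
  rw [resid23, sum_L_mul_quot aG yG A L hHn, quot]
  have hcomb : (∑ k ∈ Ico (H + 1) (n + 1), A k * (omProd L (H + 1) k * omProd L (k + 1) (n + 1)))
      + ∑ k ∈ Ico (H + 1) (n + 1), omProd L (k + 1) (n + 1) * A k * (1 - omProd L (H + 1) k)
      = ∑ k ∈ Ico (H + 1) (n + 1), omProd L (k + 1) (n + 1) * A k := by
    rw [← sum_add_distrib]
    exact sum_congr rfl fun k _ => by ring
  linear_combination (L H * omProd L 1 H * yG) * hcomb

/-- Setting the symbol L_{G_H} to 0 makes display = expression: the two agree on every monomial not containing L_{G_H} (and in the monomials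
of R_H the A-symbol is A_G or A_{G_m}, m > H: L is applied to G_H inside G′). [cite: Volkov2024PRD109, §III item 3 (arXiv v4 p.10)] -/
theorem display23_eq_expr23_of {n H : ℕ} (hH : 1 ≤ H) (hHn : H ≤ n) (h0 : L H = 0) :
    display23 aG yG A L n H = expr23 aG yG A L n := by
  rw [display23_eq aG yG A L hH hHn, resid23, h0]; ring

/-- **The 2016 form transported to U₃ = L IS the identity**: (50) with U_{G_k} ↦ L_{G_k} — the multipliers (1−L_{G_{l−1}})…(1−L_{G_H}) of line 2
and (1−L_{G_n})…(1−L_{G_H}) of line 3 KEPT, no fourth line — equals the 𝔴 = 3 expression, for every n ≥ 1 and 1 ≤ H ≤ n.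
[cite: Volkov2016, App. C eq. (50) (ZhETF 149 p.1189)] [cite: Volkov2024PRD109, §III item 3 «The last term was added to (C.7) in [69],
inappropriate (1 − U) multipliers were removed» (arXiv v4 p.10 L77)] -/
theorem eq50L_eq_expr23 {n H : ℕ} (hH : 1 ≤ H) (hHn : H ≤ n) :
    eq50 aG yG A L L n H = expr23 aG yG A L n :=
  eq50_eq_expr44 aG yG A L L hH hHn

/-- The printed lines 1–3 of 2023 with the CORRECTED fourth line − Σ_{H≤l≤n} Φ_l · L_{G_l} · (1−L_{G_{H−1}})…(1−L_{G_1}) (sum from l = H; bracket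
−L_{G_l} instead of [L_{G_l}L_{G_H} − L_{G_l}]). [cite: Volkov2024PRD109, §III item 3 (arXiv v4 p.10)] -/
def display23Corrected (n H : ℕ) : R :=
  -(∑ l ∈ Ico 1 H, yG * omProd L (l + 1) (n + 1) * A l * omProd L 1 l)
  + (∑ l ∈ Ico (H + 1) (n + 1), yG * omProd L (l + 1) (n + 1) * (L l * A H - A l) * omProd L 1 H)
  + (aG - yG * A H) * omProd L 1 H
  - ∑ l ∈ Ico H (n + 1), quot aG yG A L n l * L l * omProd L 1 H

/-- Corrected minus printed = −R_H (in the Φ-form). [cite: Volkov2024PRD109, §III item 3 (arXiv v4 p.10)] -/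
theorem display23Corrected_sub_display23 {n H : ℕ} (hHn : H ≤ n) :
    display23Corrected aG yG A L n H - display23 aG yG A L n H = -resid23 aG yG A L n H := by
  rw [resid23_eq_quot_form aG yG A L hHn, display23Corrected, display23,
    sum_eq_sum_Ico_succ_bot (by omega : H < n + 1)]
  have h4 : (∑ l ∈ Ico (H + 1) (n + 1), quot aG yG A L n l * L l * omProd L 1 H)
      + (∑ l ∈ Ico (H + 1) (n + 1), quot aG yG A L n l * (L l * L H - L l) * omProd L 1 H)
      = L H * omProd L 1 H * ∑ l ∈ Ico (H + 1) (n + 1), L l * quot aG yG A L n l := by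
    rw [mul_sum, ← sum_add_distrib]
    exact sum_congr rfl fun l _ => by ring
  linear_combination (-1 : R) * h4

/-- **With the corrected fourth line the 2023 rewriting holds** (every n ≥ 1, 1 ≤ H ≤ n). [cite: Volkov2024PRD109, §III item 3 (arXiv v4 p.10)] -/
theorem display23Corrected_eq_expr23 {n H : ℕ} (hH : 1 ≤ H) (hHn : H ≤ n) :
    display23Corrected aG yG A L n H = expr23 aG yG A L n := by
  have h1 := display23Corrected_sub_display23 aG yG A L (n := n) hHn
  have h2 := display23_eq aG yG A L hH hHn
  linear_combination h1 + h2

/-! ## §4 PRINT-CHECK DATUM: the printed display is not an identity, for any n ≥ 1 and any 1 ≤ H ≤ n -/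

/-- The ℤ-witness: at A_G = 1, L_G − (U₁)_G = 0, A_{G_k} = 0, L_{G_k} = [k = H], the residual R_H equals 1 (for every n and H).
[cite: Volkov2024PRD109, §III item 3 (arXiv v4 p.10)] -/
theorem resid23_witness (n H : ℕ) :
    resid23 (1 : ℤ) 0 (fun _ => 0) (fun k => if k = H then 1 else 0) n H = 1 := by
  unfold resid23 omProd
  simp only [if_true, zero_mul, sub_zero, mul_one, one_mul]
  refine Finset.prod_eq_one fun k hk => ?_
  simp only [mem_Ico] at hk
  simp [show k ≠ H by omega]

/-- **PRINT-CHECK DATUM.** For every n ≥ 1 and every 1 ≤ H ≤ n the printed four-line display and the expression DIFFER at the ℤ-witness (by 1).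
[cite: Volkov2024PRD109, §III item 3 (arXiv v4 p.10 L29–L78; tex l.443–461)] -/
theorem display23_ne_expr23 {n H : ℕ} (hH : 1 ≤ H) (hHn : H ≤ n) :
    display23 (1 : ℤ) 0 (fun _ => 0) (fun k => if k = H then 1 else 0) n H
      ≠ expr23 (1 : ℤ) 0 (fun _ => 0) (fun k => if k = H then 1 else 0) n := by
  rw [display23_eq (1 : ℤ) 0 (fun _ => 0) (fun k => if k = H then 1 else 0) hH hHn, resid23_witness]
  simp

/-- Hence «we rewrite the expression differently … [display]» is, AS PRINTED, not an identity of the operator symbols for any chain length and any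
index H: there is no commutative-ring-universal equality display = expression. [cite: Volkov2024PRD109, §III item 3 (arXiv v4 p.10)] -/
theorem display23_not_an_identity {n H : ℕ} (hH : 1 ≤ H) (hHn : H ≤ n) :
    ¬ ∀ (S : Type) [CommRing S] (a y : S) (B M : ℕ → S), display23 a y B M n H = expr23 a y B M n :=
  fun h => display23_ne_expr23 hH hHn (h ℤ 1 0 _ _)

end InverseTransitionRegrouping

end Literature.MathematicalPhysics.QuantumFieldTheory.Volkov2024PRD109
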